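import Literature.NumberTheory.EllipticCurves.Rank1Residual.Predicates
import Literature.NumberTheory.DiophantineGeometry.Conductor
import Mathlib.NumberTheory.ModularForms.CongruenceSubgroups
import Mathlib.AlgebraicGeometry.EllipticCurve.LFunction
import Mathlib.NumberTheory.Padics.Complex
import HarnessLib

/-!
# Crux `ThetaLayerLambdaCongruenceAtTwo` (stmt-BirchSwinnertonDyer-20688, route ResidualThetaTransportAtTwo), line
# `birth`: the plus-line stub (C3) `stub_plusLineAtTwo` REDUCED TO ITS RESIDUE-FIELD FORM (C3k) — «plus
# multiplicity one for Γ₀(N')-symbol functions over a field of characteristic 2» (lead prover bsd-wall-rtt-p3 g3;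
# `--supports stmt-BirchSwinnertonDyer-20688 --as helper`; closes nothing)

HONEST FRAMING. THEOREMS ONLY; the research input (C3k) is an explicit hypothesis spelled inline; nothing about any
curve or form is asserted; BSD is not proved by any of this. This is piece (P7) «lift» of the formalisation plan
`Cruxes/ThetaLayerLambdaCongruenceAtTwo/Lines/birth-C3-plan.md`.

WHAT. (C3) (skeleton v7, verbatim below as the CONCLUSION of `plusLineAtTwo_of_charTwo`) speaks about two integral
primitive functions `Φ₁, Φ₂ : ℚ → ℚ̄₂` that are `1`-periodic, even, Γ₀(N')-symbol functions (Manin's relation) and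
Hecke-eigen MODULO THE MAXIMAL IDEAL of `ℚ̄₂` (`‖T_qΦ − a_q(W)Φ‖ < 1`, `‖U_ℓΦ‖ < 1`), and concludes
`∃ a, ‖aΦ₁ − Φ₂‖ < 1` pointwise. Its mathematical content lives entirely in the residue field `𝓀 = 𝒪_{ℚ̄₂}/𝔪 ≅ 𝔽̄₂`:
(C3k) «for every field `k` of characteristic `2`, two NONZERO functions `Ψ₁, Ψ₂ : ℚ → k` that are `1`-periodic,
even, Γ₀(N')-symbol functions and EXACT Hecke eigenfunctions for the system `T_q ↦ a_q(W)` (`q ∤ N'`), `U_ℓ ↦ 0`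
(`ℓ ∣ N'`) are proportional: `Ψ₂ = c·Ψ₁`» — i.e. the simultaneous eigenspace in `Symb_{Γ₀(N')}(k)⁺` is a `k`-line.
* §0 reduction modulo `𝔪` in `ℚ̄₂` (`𝒪 = Valued.integer ℚ̄₂`, `𝓀 = IsLocalRing.ResidueField 𝒪`, Mathlib's; adapted
  from the `p = 3` twin `…KimAtThreeDeepLowerOffStratumLevelLoweringVatsal` §0): norm/valuation dictionary, `char 𝓀 = 2`,
  residues of integers.
* §1 `plusLineAtTwo_of_charTwo` : (C3k) ⟹ (C3). Proof: reduce `Φᵢ` to `Ψᵢ = Φᵢ mod 𝔪 : ℚ → 𝓀` (a ring map, so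
  every hypothesis of (C3) becomes the corresponding exact hypothesis of (C3k); primitivity becomes `Ψᵢ ≠ 0`), get
  `c ∈ 𝓀`, lift it to `a ∈ 𝒪`; then `aΦ₁(r) − Φ₂(r) ∈ 𝔪`, i.e. `‖aΦ₁(r) − Φ₂(r)‖ < 1`.
So the skeleton's research stub may be taken to be (C3k) (skeleton v8): pure characteristic-`2` linear algebra of
Manin functions plus ONE Literature fact (Ribet–Stein Thm. 3.5 / Buzzard at `ℓ = 2`), with no `2`-adic analysis
left in it.

References: [Manin1972] §1.5–1.7; [GreenbergVatsal2000] §3 (reduction of symbols mod `𝔭`); [Vatsal1999] §1.4–1.6.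
-/

noncomputable section

-- justification: the `Summit.BirchSwinnertonDyer.BirchSwinnertonDyer.…` path repeats a component (route-file convention)
set_option linter.dupNamespace false

open scoped Classical MatrixGroups

open CongruenceSubgroup

namespace Summit.BirchSwinnertonDyer.BirchSwinnertonDyer.Theorems.ThetaLayerLambdaCongruenceAtTwo

/-! ## §0. Reduction modulo the maximal ideal of `𝒪_{ℚ̄₂}` (no definitions; Mathlib's `Valued.integer`,
`IsLocalRing.ResidueField`, `IsLocalRing.residue`) -/

section Residue

-- adapted from Summits/…/Theorems/KimAtThreeDeepLowerOffStratumLevelLoweringVatsal.lean §0 (the `p = 3` twin)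

/-- `‖x‖ ≤ 1` iff `x ∈ 𝒪_{ℚ̄₂}`. [folklore] -/
theorem mem_integer_two_iff_norm_le_one {x : PadicAlgCl 2} :
    x ∈ Valued.integer (PadicAlgCl 2) ↔ ‖x‖ ≤ 1 := by
  rw [Valuation.mem_integer_iff, PadicAlgCl.valuation_def, ← NNReal.coe_le_coe, coe_nnnorm, NNReal.coe_one]

/-- An element of `𝒪_{ℚ̄₂}` has residue `0` iff its norm is `< 1` (it lies in the maximal ideal). [folklore] -/
theorem residue_two_mk_eq_zero_iff {x : PadicAlgCl 2} (hx : x ∈ Valued.integer (PadicAlgCl 2)) :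
    IsLocalRing.residue (Valued.integer (PadicAlgCl 2)) ⟨x, hx⟩ = 0 ↔ ‖x‖ < 1 := by
  rw [IsLocalRing.residue_eq_zero_iff, IsLocalRing.mem_maximalIdeal, mem_nonunits_iff,
    Valuation.Integer.not_isUnit_iff_valuation_lt_one, PadicAlgCl.valuation_def]
  exact_mod_cast Iff.rfl

/-- The residue of `x ∈ 𝒪_{ℚ̄₂}` vanishes iff `‖x‖ < 1` (subtype form). [folklore] -/
theorem residue_two_eq_zero_iff (x : Valued.integer (PadicAlgCl 2)) :
    IsLocalRing.residue (Valued.integer (PadicAlgCl 2)) x = 0 ↔ ‖(x : PadicAlgCl 2)‖ < 1 :=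
  residue_two_mk_eq_zero_iff x.2

/-- Integers lie in `𝒪_{ℚ̄₂}`. [folklore] -/
theorem norm_intCast_padicAlgCl_two_le_one (z : ℤ) : ‖(z : PadicAlgCl 2)‖ ≤ 1 := by
  rw [show (z : PadicAlgCl 2) = ((z : ℚ_[2]) : PadicAlgCl 2) by rfl, PadicAlgCl.norm_extends]
  exact Padic.norm_int_le_one z

/-- The residue of an integer is its image in `𝓀`. [folklore] -/
theorem residue_two_mk_intCast (z : ℤ) (hz : (z : PadicAlgCl 2) ∈ Valued.integer (PadicAlgCl 2)) :
    IsLocalRing.residue (Valued.integer (PadicAlgCl 2)) ⟨(z : PadicAlgCl 2), hz⟩ = (z : _) := by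
  rw [← map_intCast (IsLocalRing.residue (Valued.integer (PadicAlgCl 2))) z]
  rfl

/-- **The residue field `𝓀 = 𝒪_{ℚ̄₂}/𝔪` has characteristic `2`.** [folklore] -/
theorem charP_residueField_two : CharP (IsLocalRing.ResidueField (Valued.integer (PadicAlgCl 2))) 2 := by
  have h2 : ‖((2 : ℤ) : PadicAlgCl 2)‖ < 1 := by
    rw [show ((2 : ℤ) : PadicAlgCl 2) = (((2 : ℤ) : ℚ_[2]) : PadicAlgCl 2) by push_cast; rfl,
      PadicAlgCl.norm_extends]
    exact (Padic.norm_intCast_lt_one_iff (p := 2) (k := 2)).mpr (dvd_refl _)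
  have h0 : ((2 : ℕ) : IsLocalRing.ResidueField (Valued.integer (PadicAlgCl 2))) = 0 := by
    have := (residue_two_mk_eq_zero_iff (mem_integer_two_iff_norm_le_one.mpr h2.le)).mpr h2
    rw [residue_two_mk_intCast] at this
    exact_mod_cast this
  exact (CharP.charP_iff_prime_eq_zero Nat.prime_two).2 h0

end Residue

/-! ## §1. (C3k) «plus multiplicity one over fields of characteristic 2» ⟹ (C3) `stub_plusLineAtTwo` -/

section Glue

/-- **(C3k) ⟹ (C3).** The plus-line stub (C3) of line `birth` (skeleton v7, VERBATIM as the conclusion) follows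
from its residue-field form (C3k) (VERBATIM as the hypothesis): «for `W/ℚ` good supersingular at `2` with
`Δ_W < 0`, every odd `N'` divisible by the primes of `N_W`, every field `k` of characteristic `2` and all NONZERO
`Ψ₁, Ψ₂ : ℚ → k` that are `1`-periodic, even, Γ₀(N')-symbol functions (Manin's relation) and exact Hecke
eigenfunctions for `T_q ↦ a_q(W)` (primes `q ∤ N'`; `a_q(W) = W.LFunction q ∈ ℤ` read in `k`) and `U_ℓ ↦ 0` (primes
`ℓ ∣ N'`): `∃ c ∈ k, Ψ₂ = c·Ψ₁`». Proof: reduce modulo the maximal ideal of `𝒪_{ℚ̄₂}` (§0), apply (C3k) with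
`k = 𝓀`, lift the scalar. [cite: GreenbergVatsal2000, §3] -/
theorem plusLineAtTwo_of_charTwo
    (hk : ∀ (W : WeierstrassCurve ℚ) [W.IsElliptic] [W.IsGloballyMinimal], Literature.NumberTheory.EllipticCurves.Rank1Residual.GoodSS W 2 → W.Δ < 0 → ∀ (N' : ℕ), Odd N' → (∀ ℓ : ℕ, ℓ.Prime → ℓ ∣ W.conductorNorm ℤ → ℓ ∣ N') → ∀ (k : Type) [Field k] [CharP k 2] (Ψ₁ Ψ₂ : ℚ → k), (∀ (r : ℚ) (z : ℤ), Ψ₁ (r + z) = Ψ₁ r) → (∀ r : ℚ, Ψ₁ (-r) = Ψ₁ r) → (∀ (γ : CongruenceSubgroup.Gamma0 (N')) (r : ℚ), ((γ : SL(2, ℤ)) 1 0 : ℚ) * r + ((γ : SL(2, ℤ)) 1 1 : ℚ) ≠ 0 → Ψ₁ ((((γ : SL(2, ℤ)) 0 0 : ℚ) * r + ((γ : SL(2, ℤ)) 0 1 : ℚ)) / (((γ : SL(2, ℤ)) 1 0 : ℚ) * r + ((γ : SL(2, ℤ)) 1 1 : ℚ))) = (if ((γ : SL(2, ℤ)) 1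 0) = 0 then 0 else Ψ₁ ((((γ : SL(2, ℤ)) 0 0 : ℚ)) / (((γ : SL(2, ℤ)) 1 0 : ℚ)))) + Ψ₁ r) → (∀ (r : ℚ) (z : ℤ), Ψ₂ (r + z) = Ψ₂ r) → (∀ r : ℚ, Ψ₂ (-r) = Ψ₂ r) → (∀ (γ : CongruenceSubgroup.Gamma0 (N')) (r : ℚ), ((γ : SL(2, ℤ)) 1 0 : ℚ) * r + ((γ : SL(2, ℤ)) 1 1 : ℚ) ≠ 0 → Ψ₂ ((((γ : SL(2, ℤ)) 0 0 : ℚ) * r + ((γ : SL(2, ℤ)) 0 1 : ℚ)) / (((γ : SL(2, ℤ)) 1 0 : ℚ) * r + ((γ : SL(2, ℤ)) 1 1 : ℚ))) = (if ((γ : SL(2, ℤ)) 1 0) = 0 then 0 else Ψ₂ ((((γ : SL(2, ℤ)) 0 0 : ℚ)) / (((γ : SL(2, ℤ)) 1 0 : ℚ)))) + Ψ₂ r) → (∃ r : ℚ, Ψ₁ r ≠ 0) → (∃ r : ℚ, Ψ₂ r ≠ 0) → (∀ q : ℕ, q.Prime → ¬ q ∣ N' → ∀ r : ℚ, (∑ j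 : Fin q, Ψ₁ ((r + j) / q)) + Ψ₁ (q * r) = (W.LFunction q : k) * Ψ₁ r) → (∀ q : ℕ, q.Prime → ¬ q ∣ N' → ∀ r : ℚ, (∑ j : Fin q, Ψ₂ ((r + j) / q)) + Ψ₂ (q * r) = (W.LFunction q : k) * Ψ₂ r) → (∀ ℓ : ℕ, ℓ.Prime → ℓ ∣ N' → ∀ r : ℚ, ∑ j : Fin ℓ, Ψ₁ ((r + j) / ℓ) = 0) → (∀ ℓ : ℕ, ℓ.Prime → ℓ ∣ N' → ∀ r : ℚ, ∑ j : Fin ℓ, Ψ₂ ((r + j) / ℓ) = 0) → ∃ c : k, ∀ r : ℚ, Ψ₂ r = c * Ψ₁ r) :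
    ∀ (W : WeierstrassCurve ℚ) [W.IsElliptic] [W.IsGloballyMinimal], Literature.NumberTheory.EllipticCurves.Rank1Residual.GoodSS W 2 → W.Δ < 0 → ∀ (N' : ℕ), Odd N' → (∀ ℓ : ℕ, ℓ.Prime → ℓ ∣ W.conductorNorm ℤ → ℓ ∣ N') → ∀ (Φ₁ Φ₂ : ℚ → PadicAlgCl 2), (∀ (r : ℚ) (z : ℤ), Φ₁ (r + z) = Φ₁ r) → (∀ r : ℚ, Φ₁ (-r) = Φ₁ r) → (∀ (γ : CongruenceSubgroup.Gamma0 (N')) (r : ℚ), ((γ : SL(2, ℤ)) 1 0 : ℚ) * r + ((γ : SL(2, ℤ)) 1 1 : ℚ) ≠ 0 → Φ₁ ((((γ : SL(2, ℤ)) 0 0 : ℚ) * r + ((γ : SL(2, ℤ)) 0 1 : ℚ)) / (((γ : SL(2, ℤ)) 1 0 : ℚ) * r + ((γ : SL(2, ℤ)) 1 1 : ℚ))) = (if ((γ : SL(2, ℤ)) 1 0) = 0 then 0 else Φ₁ ((((γ : SL(2, ℤ)) 0 0 : ℚ)) / (((γ : SL(2, ℤ)) 1 0 : ℚ)))) + Φ₁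 r) → (∀ (r : ℚ) (z : ℤ), Φ₂ (r + z) = Φ₂ r) → (∀ r : ℚ, Φ₂ (-r) = Φ₂ r) → (∀ (γ : CongruenceSubgroup.Gamma0 (N')) (r : ℚ), ((γ : SL(2, ℤ)) 1 0 : ℚ) * r + ((γ : SL(2, ℤ)) 1 1 : ℚ) ≠ 0 → Φ₂ ((((γ : SL(2, ℤ)) 0 0 : ℚ) * r + ((γ : SL(2, ℤ)) 0 1 : ℚ)) / (((γ : SL(2, ℤ)) 1 0 : ℚ) * r + ((γ : SL(2, ℤ)) 1 1 : ℚ))) = (if ((γ : SL(2, ℤ)) 1 0) = 0 then 0 else Φ₂ ((((γ : SL(2, ℤ)) 0 0 : ℚ)) / (((γ : SL(2, ℤ)) 1 0 : ℚ)))) + Φ₂ r) → (∀ r : ℚ, ‖Φ₁ r‖ ≤ 1) → (∀ r : ℚ, ‖Φ₂ r‖ ≤ 1) → (∃ r : ℚ, ‖Φ₁ r‖ = 1) → (∃ r : ℚ, ‖Φ₂ r‖ = 1) → (∀ q : ℕ, q.Prime → ¬ q ∣ N' → ∀ r : ℚ, ‖(∑ j : Fin q, Φ₁ ((r + j) / q))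 + Φ₁ (q * r) - (W.LFunction q : PadicAlgCl 2) * Φ₁ r‖ < 1) → (∀ q : ℕ, q.Prime → ¬ q ∣ N' → ∀ r : ℚ, ‖(∑ j : Fin q, Φ₂ ((r + j) / q)) + Φ₂ (q * r) - (W.LFunction q : PadicAlgCl 2) * Φ₂ r‖ < 1) → (∀ ℓ : ℕ, ℓ.Prime → ℓ ∣ N' → ∀ r : ℚ, ‖∑ j : Fin ℓ, Φ₁ ((r + j) / ℓ)‖ < 1) → (∀ ℓ : ℕ, ℓ.Prime → ℓ ∣ N' → ∀ r : ℚ, ‖∑ j : Fin ℓ, Φ₂ ((r + j) / ℓ)‖ < 1) → ∃ a : PadicAlgCl 2, ∀ r : ℚ, ‖a * Φ₁ r - Φ₂ r‖ < 1 := by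
  intro W _ _ hss hΔ N' hN' hprimes Φ₁ Φ₂ hper₁ hev₁ hM₁ hper₂ hev₂ hM₂ hle₁ hle₂ hprim₁ hprim₂ hT₁ hT₂ hU₁ hU₂
  haveI := charP_residueField_two
  -- the reductions `Ψᵢ = Φᵢ mod 𝔪 : ℚ → 𝓀`
  set res := IsLocalRing.residue (Valued.integer (PadicAlgCl 2)) with hres
  have m₁ : ∀ r : ℚ, Φ₁ r ∈ Valued.integer (PadicAlgCl 2) :=
    fun r ↦ mem_integer_two_iff_norm_le_one.mpr (hle₁ r)
  have m₂ : ∀ r : ℚ, Φ₂ r ∈ Valued.integer (PadicAlgCl 2) :=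
    fun r ↦ mem_integer_two_iff_norm_le_one.mpr (hle₂ r)
  set Ψ₁ : ℚ → IsLocalRing.ResidueField (Valued.integer (PadicAlgCl 2)) := fun r ↦ res ⟨Φ₁ r, m₁ r⟩ with hΨ₁
  set Ψ₂ : ℚ → IsLocalRing.ResidueField (Valued.integer (PadicAlgCl 2)) := fun r ↦ res ⟨Φ₂ r, m₂ r⟩ with hΨ₂
  -- generic transfer lemmas for a reduction `Ψ = Φ mod 𝔪`
  have transfer_per : ∀ (Φ : ℚ → PadicAlgCl 2) (m : ∀ r : ℚ, Φ r ∈ Valued.integer (PadicAlgCl 2)),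
      (∀ (r : ℚ) (z : ℤ), Φ (r + z) = Φ r) → ∀ (r : ℚ) (z : ℤ),
        res ⟨Φ (r + z), m (r + z)⟩ = res ⟨Φ r, m r⟩ := by
    intro Φ m hper r z
    congr 1
    exact Subtype.ext (hper r z)
  have transfer_ev : ∀ (Φ : ℚ → PadicAlgCl 2) (m : ∀ r : ℚ, Φ r ∈ Valued.integer (PadicAlgCl 2)),
      (∀ r : ℚ, Φ (-r) = Φ r) → ∀ r : ℚ, res ⟨Φ (-r), m (-r)⟩ = res ⟨Φ r, m r⟩ := by
    intro Φ m hev r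
    congr 1
    exact Subtype.ext (hev r)
  have transfer_M : ∀ (Φ : ℚ → PadicAlgCl 2) (m : ∀ r : ℚ, Φ r ∈ Valued.integer (PadicAlgCl 2)),
      (∀ (γ : CongruenceSubgroup.Gamma0 (N')) (r : ℚ), ((γ : SL(2, ℤ)) 1 0 : ℚ) * r + ((γ : SL(2, ℤ)) 1 1 : ℚ) ≠ 0 → Φ ((((γ : SL(2, ℤ)) 0 0 : ℚ) * r + ((γ : SL(2, ℤ)) 0 1 : ℚ)) / (((γ : SL(2, ℤ)) 1 0 : ℚ) * r + ((γ : SL(2, ℤ)) 1 1 : ℚ))) = (if ((γ : SL(2, ℤ)) 1 0) = 0 then 0 else Φ ((((γ : SL(2, ℤ)) 0 0 : ℚ)) / (((γ : SL(2, ℤ)) 1 0 : ℚ)))) + Φ r) →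
      ∀ (γ : CongruenceSubgroup.Gamma0 (N')) (r : ℚ), ((γ : SL(2, ℤ)) 1 0 : ℚ) * r + ((γ : SL(2, ℤ)) 1 1 : ℚ) ≠ 0 →
        res ⟨Φ ((((γ : SL(2, ℤ)) 0 0 : ℚ) * r + ((γ : SL(2, ℤ)) 0 1 : ℚ)) / (((γ : SL(2, ℤ)) 1 0 : ℚ) * r + ((γ : SL(2, ℤ)) 1 1 : ℚ))), m _⟩ =
          (if ((γ : SL(2, ℤ)) 1 0) = 0 then 0 else res ⟨Φ ((((γ : SL(2, ℤ)) 0 0 : ℚ)) / (((γ : SL(2, ℤ)) 1 0 : ℚ))), m _⟩) + res ⟨Φ r, m r⟩ := by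
    intro Φ m hM γ r hr
    have h := hM γ r hr
    by_cases hc : (γ : SL(2, ℤ)) 1 0 = 0
    · rw [if_pos hc, zero_add] at h
      rw [if_pos hc, zero_add]
      congr 1
      exact Subtype.ext h
    · rw [if_neg hc] at h
      rw [if_neg hc, ← map_add]
      congr 1
      exact Subtype.ext h
  have transfer_ne : ∀ (Φ : ℚ → PadicAlgCl 2) (m : ∀ r : ℚ, Φ r ∈ Valued.integer (PadicAlgCl 2)),
      (∃ r : ℚ, ‖Φ r‖ = 1) → ∃ r : ℚ, res ⟨Φ r, m r⟩ ≠ 0 := by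
    rintro Φ m ⟨r, hr⟩
    refine ⟨r, fun h ↦ ?_⟩
    have := (residue_two_mk_eq_zero_iff (m r)).mp h
    rw [hr] at this
    exact lt_irrefl _ this
  have transfer_T : ∀ (Φ : ℚ → PadicAlgCl 2) (m : ∀ r : ℚ, Φ r ∈ Valued.integer (PadicAlgCl 2)),
      (∀ q : ℕ, q.Prime → ¬ q ∣ N' → ∀ r : ℚ, ‖(∑ j : Fin q, Φ ((r + j) / q)) + Φ (q * r) - (W.LFunction q : PadicAlgCl 2) * Φ r‖ < 1) →
      ∀ q : ℕ, q.Prime → ¬ q ∣ N' → ∀ r : ℚ, (∑ j : Fin q, res ⟨Φ ((r + j) / q), m _⟩) + res ⟨Φ (q * r), m _⟩ =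
        (W.LFunction q : IsLocalRing.ResidueField (Valued.integer (PadicAlgCl 2))) * res ⟨Φ r, m r⟩ := by
    intro Φ m hT q hq hqN r
    have ma : ((W.LFunction q : ℤ) : PadicAlgCl 2) ∈ Valued.integer (PadicAlgCl 2) :=
      mem_integer_two_iff_norm_le_one.mpr (norm_intCast_padicAlgCl_two_le_one _)
    -- the element `T_qΦ(r) − a_q Φ(r)` of `𝒪`
    set E : Valued.integer (PadicAlgCl 2) :=
      (∑ j : Fin q, (⟨Φ ((r + j) / q), m _⟩ : Valued.integer (PadicAlgCl 2))) + ⟨Φ (q * r), m _⟩ -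
        ⟨((W.LFunction q : ℤ) : PadicAlgCl 2), ma⟩ * ⟨Φ r, m r⟩ with hE
    have hEval : (E : PadicAlgCl 2) =
        (∑ j : Fin q, Φ ((r + j) / q)) + Φ (q * r) - (W.LFunction q : PadicAlgCl 2) * Φ r := by
      rw [hE]; push_cast; rfl
    have hE0 : res E = 0 := by
      rw [hres, residue_two_eq_zero_iff, hEval]; exact hT q hq hqN r
    rw [hE, map_sub, map_add, map_sum, map_mul, sub_eq_zero] at hE0
    rw [hE0, residue_two_mk_intCast _ ma]
  have transfer_U : ∀ (Φ : ℚ → PadicAlgCl 2) (m : ∀ r : ℚ, Φ r ∈ Valued.integer (PadicAlgCl 2)),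
      (∀ ℓ : ℕ, ℓ.Prime → ℓ ∣ N' → ∀ r : ℚ, ‖∑ j : Fin ℓ, Φ ((r + j) / ℓ)‖ < 1) →
      ∀ ℓ : ℕ, ℓ.Prime → ℓ ∣ N' → ∀ r : ℚ, ∑ j : Fin ℓ, res ⟨Φ ((r + j) / ℓ), m _⟩ = 0 := by
    intro Φ m hU ℓ hℓ hℓN r
    set E : Valued.integer (PadicAlgCl 2) :=
      ∑ j : Fin ℓ, (⟨Φ ((r + j) / ℓ), m _⟩ : Valued.integer (PadicAlgCl 2)) with hE
    have hEval : (E : PadicAlgCl 2) = ∑ j : Fin ℓ, Φ ((r + j) / ℓ) := by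
      rw [hE]; push_cast; rfl
    have hE0 : res E = 0 := by
      rw [hres, residue_two_eq_zero_iff, hEval]; exact hU ℓ hℓ hℓN r
    rw [hE, map_sum] at hE0
    exact hE0
  -- apply (C3k) in the residue field
  obtain ⟨c, hc⟩ := hk W hss hΔ N' hN' hprimes (IsLocalRing.ResidueField (Valued.integer (PadicAlgCl 2))) Ψ₁ Ψ₂
    (transfer_per Φ₁ m₁ hper₁) (transfer_ev Φ₁ m₁ hev₁) (transfer_M Φ₁ m₁ hM₁)
    (transfer_per Φ₂ m₂ hper₂) (transfer_ev Φ₂ m₂ hev₂) (transfer_M Φ₂ m₂ hM₂)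
    (transfer_ne Φ₁ m₁ hprim₁) (transfer_ne Φ₂ m₂ hprim₂)
    (transfer_T Φ₁ m₁ hT₁) (transfer_T Φ₂ m₂ hT₂) (transfer_U Φ₁ m₁ hU₁) (transfer_U Φ₂ m₂ hU₂)
  -- lift the scalar
  obtain ⟨a, ha⟩ := IsLocalRing.residue_surjective c
  refine ⟨(a : PadicAlgCl 2), fun r ↦ ?_⟩
  have hmem : (a : PadicAlgCl 2) * Φ₁ r - Φ₂ r ∈ Valued.integer (PadicAlgCl 2) :=
    sub_mem (mul_mem a.2 (m₁ r)) (m₂ r)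
  refine (residue_two_mk_eq_zero_iff hmem).mp ?_
  have e : (⟨(a : PadicAlgCl 2) * Φ₁ r - Φ₂ r, hmem⟩ : Valued.integer (PadicAlgCl 2)) =
      a * ⟨Φ₁ r, m₁ r⟩ - ⟨Φ₂ r, m₂ r⟩ := Subtype.ext rfl
  rw [e, map_sub, map_mul, ← hres, ha]
  change c * Ψ₁ r - Ψ₂ r = 0
  rw [hc r, sub_self]

end Glue

end Summit.BirchSwinnertonDyer.BirchSwinnertonDyer.Theorems.ThetaLayerLambdaCongruenceAtTwo

end
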